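import Literature.Probability.RandomPlanarGeometry.HexSAWStripWidthTwoHatConvergence
import Literature.Probability.RandomPlanarGeometry.HexSAWStripBridgeContactLLN
import HarnessLib

/-!
# The width-two strip: the CONTACT hat sums obey the inhomogeneous first-order recursions `Ĉ(k+1) = G·Ĉ(k) + K₁·D̂(k)`,
# `Ĉ²(k+1) = G·Ĉ²(k) + K₁·D̂(k) + 2·K₁·Ĉ(k)`, and `Ĉ` unrolls to a finite convolution of powers of `G` (module «WIDTH-TWO CONTACT RECURSION»)

Topic `Literature/Probability/RandomPlanarGeometry` (continues «WIDTH-TWO HAT RECURSION» / «WIDTH-TWO HAT CONVERGENCE» — `W2.gTwo`, `W2.hatMZeroTwo`,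
`W2.hatMOneTwo`, `W2.hatM_two_zero/one/eq_zero`, `W2.hatD_two_succ`, `W2.hatD_two_zero`, `W2.hatD_two_eq_pow_mul` — and «CONTACT-DENSITY-POINTWISE» #687
`HexSAWStripBridgeContactDensityPointwise.lean` — the contact renewal equation `HV.hat_contact_ren : Ĉ_D(k) = Ĉ_M(k) + Σ_{i+j=k} (Ĉ_M(i)·D̂(j) + M̂(i)·Ĉ_D(j))`
— and «CONTACT-LLN» #750 `HexSAWStripBridgeContactLLN.lean` — `HV.hat_contactSq_ren : Ĉ²_D(k) = Ĉ²_M(k) + Σ_{i+j=k} (Ĉ²_M(i)·D̂(j) + 2·Ĉ_M(i)·Ĉ_D(j) + M̂(i)·Ĉ²_D(j))`;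
uses «WIDTH-TWO-KERNEL» #715 (`mem_HBk_two_one`, `HBk_two_pair`, `topCnt_tail_irr`, `wD_irr`)).
Lane «pcv-sawmu» (CriticalPhenomena venture), a-p2 g26 — CAR V-C part 1 of the variance-rate design (`HOME/pub-sawmu-a-p2/g26/DESIGN-VARIANCE-RATE-T2.md` §4).
At `T = 2` the contact-weighted irreducible hat kernel is the single matrix `Ĉ_M(1) = x·y·E₂₃` (the one irreducible bridge touching the surface, the
up-step `2 → 3`), so the contact renewal equation collapses — exactly like the bridge one — to `Ĉ_D(k+1) = G·Ĉ_D(k) + K₁·D̂(k)` with `K₁ = (1 + M̂(0))·Ĉ_M(1)`,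
and unrolls to `Ĉ_D(k+1) = Σ_{j ≤ k} G^{k−j}·K₁·G^j·(1 + M̂(0))`: a finite convolution of the two geometric matrix sequences of the previous cars, ready for the
`cauchyProdCoeff` asymptotics of «CONVOLUTION ASYMPTOTICS».  Sources of the SETTING: W. Feller I (1968) XIII.3 (renewal equation), XIII.6 (moments of
renewal counts); H. Duminil-Copin, A. Hammond, CMP 324 (2013) §2.2.  Nothing below is printed.

## What is proved (namespace `…SAW.HV.W2`; `x = x_c`)

* `hatCD y k` / `hatCM y k` — names for the contact hat sums of #687 at `T = 2`; `cOneTwo y = x·y·E₂₃`, `kOneTwo y` = the matrix with entries `(2,3) = xy`,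
  `(3,3) = x²y`; `kOneTwo_eq : K₁ = (1 + M̂(0))·Ĉ_M(1)`; `hatCD_ren` = #687's renewal equation in these names.
* ★ `hatCM_two_eq : Ĉ_M(k) = if k = 1 then cOneTwo y else 0`; `hatCD_two_zero : Ĉ_D(0) = 0`; ★ `hatCD_two_one : Ĉ_D(1) = K₁·(1 + M̂(0))`.
* ★★★ **`hatCD_two_succ : Ĉ_D(k+1) = G·Ĉ_D(k) + K₁·D̂(k)`** for `k ≥ 1`, `0 < y`.
* ★★ **`hatCD_two_eq_sum : Ĉ_D(k+1) = Σ_{j ≤ k} G^{k−j}·K₁·G^j·(1 + M̂(0))`** for every `k`, `0 < y`.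
* `hatC2D y k` / `hatC2M y k` — the squared-contact hat sums of #750 at `T = 2`; `hatC2M_two_eq : Ĉ²_M(k) = Ĉ_M(k)` (an irreducible bridge of `S₂` has at most one
  contact); `hatC2D_ren`; `hatC2D_two_zero : Ĉ²_D(0) = 0`; `hatC2D_two_one : Ĉ²_D(1) = K₁·(1 + M̂(0))`;
  ★★★ **`hatC2D_two_succ : Ĉ²_D(k+1) = G·Ĉ²_D(k) + K₁·D̂(k) + 2·(K₁·Ĉ_D(k))`** for `k ≥ 1`, `0 < y`.

Label: LANE THEOREM (own result of lane «pcv-sawmu», a-p2 g26, 2026-08-27; not in print).  NOT claimed: the unrolled form of `Ĉ²` (a double convolution),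
the entrywise asymptotics `Ĉ_D(k)_{ab} = A_{ab}·k + B_{ab} + o(1)`, `Ĉ²_D(k)_{ab} = A²_{ab}k² + … ` and the variance rate `σ₂²` — next car, by «CONVOLUTION
ASYMPTOTICS» applied to these recursions.
-/

noncomputable section

open Finset Filter Topology Matrix Literature.Probability.LatticeModels Literature.Probability.Percolation

namespace Literature.Probability.RandomPlanarGeometry.SAW

namespace HV

namespace W2

/-- The contact-weighted hat bridge sum of `S₂`: `Ĉ_D(k)_{ab} = Σ_{bridges a→b with 2k+χ_a−χ_b steps} #top · wD` (the matrix of #687's `hat_contact_ren`).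
[cite: Feller1968, XIII.6; DuminilCopinHammond2013, §2.2; lane «pcv-sawmu» a-p2 g26] -/
def hatCD (y : ℝ) (k : ℕ) : Matrix (Fin (2 * 2)) (Fin (2 * 2)) ℝ :=
  Matrix.of fun a b : Fin (2 * 2) => ∑ l ∈ LUset 2 (2 * k + 1) (hatLen k a b) (a : ℕ) (b : ℕ), (topCnt 2 l.tail : ℝ) * wD 2 y l

/-- The contact-weighted hat irreducible sum of `S₂`: `Ĉ_M(k)_{ab} = Σ_{irreducible bridges a→b with 2k+χ_a−χ_b steps} #top · wD`.
[cite: Feller1968, XIII.6; DuminilCopinHammond2013, §2.2; lane «pcv-sawmu» a-p2 g26] -/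
def hatCM (y : ℝ) (k : ℕ) : Matrix (Fin (2 * 2)) (Fin (2 * 2)) ℝ :=
  Matrix.of fun a b : Fin (2 * 2) => ∑ l ∈ LMset 2 (2 * k + 1) (hatLen k a b) (a : ℕ) (b : ℕ), (topCnt 2 l.tail : ℝ) * wD 2 y l

/-- `Ĉ_M(1) = x·y·E₂₃`: the only irreducible bridge of `S₂` with a surface contact in its tail is the up-step `2 → 3`.
[cite: DuminilCopinHammond2013, §2.2; lane «pcv-sawmu» a-p2 g26] -/
def cOneTwo (y : ℝ) : Matrix (Fin (2 * 2)) (Fin (2 * 2)) ℝ :=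
  Matrix.of ![![0, 0, 0, 0], ![0, 0, 0, 0], ![0, 0, 0, hexCriticalFugacity * y], ![0, 0, 0, 0]]

/-- The contact forcing matrix `K₁ = (1 + M̂(0))·Ĉ_M(1)`: entries `(2,3) = x·y`, `(3,3) = x²·y`, all others `0`. [cite: Feller1968, XIII.6; lane «pcv-sawmu» a-p2 g26] -/
def kOneTwo (y : ℝ) : Matrix (Fin (2 * 2)) (Fin (2 * 2)) ℝ :=
  Matrix.of ![![0, 0, 0, 0], ![0, 0, 0, 0], ![0, 0, 0, hexCriticalFugacity * y], ![0, 0, 0, hexCriticalFugacity ^ 2 * y]]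

/-- `K₁ = (1 + M̂(0))·Ĉ_M(1)`. [cite: Feller1968, XIII.6; lane plumbing] -/
theorem kOneTwo_eq (y : ℝ) : kOneTwo y = (1 + hatMZeroTwo) * cOneTwo y := by
  ext a b
  fin_cases a <;> fin_cases b <;> simp [kOneTwo, cOneTwo, hatMZeroTwo, Matrix.mul_apply, Matrix.add_apply, Fin.sum_univ_four]
  ring

/-- #687's contact renewal equation at `T = 2`, in the names of this file: `Ĉ_D(k) = Ĉ_M(k) + Σ_{i+j=k} (Ĉ_M(i)·D̂(j) + M̂(i)·Ĉ_D(j))` (`0 < y`).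
[cite: Feller1968, XIII.3; DuminilCopinHammond2013, §2.2; lane plumbing] -/
theorem hatCD_ren {y : ℝ} (hy : 0 < y) (k : ℕ) :
    hatCD y k = hatCM y k + ∑ p ∈ antidiagonal k, (hatCM y p.1 * hatD 2 y p.2 + hatM 2 y p.1 * hatCD y p.2) :=
  hat_contact_ren (T := 2) hy k

/-- The entries of the contact hat kernel of `S₂`: `Ĉ_M(k)_{ab} = x·y` if `(a,b,k) = (2,3,1)` and `0` otherwise — of the six irreducible bridges of #715
(`W2.mem_HBk_two_one`) only `2 → 3` has a surface contact in its tail (`W2.topCnt_tail_irr`), and its hat index is `1`.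
[cite: DuminilCopinHammond2013, §2.2; lane «pcv-sawmu» a-p2 g26 — own] -/
theorem hatCM_two_apply (y : ℝ) (k : ℕ) (a b : Fin (2 * 2)) :
    hatCM y k a b = if (a : ℕ) = 2 ∧ (b : ℕ) = 3 ∧ k = 1 then hexCriticalFugacity * y else 0 := by
  obtain ⟨t01, t10, t23, t32, t02, t31⟩ := topCnt_tail_irr
  have hl23 : hlen irr23 = 1 := by simp [hlen, irr23]
  rw [hatCM, Matrix.of_apply]
  by_cases h : (a : ℕ) = 2 ∧ (b : ℕ) = 3 ∧ k = 1
  · obtain ⟨ha, hb, rfl⟩ := h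
    rw [if_pos ⟨ha, hb, rfl⟩]
    have hσ : hatLen 1 a b = 1 := by
      unfold hatLen lchi
      rw [ha, hb]
      norm_num
    obtain ⟨-, -, h23, -⟩ := HBk_two_pair (N := 2 * 1 + 1) (by norm_num)
    rw [hσ, LMset, ha, hb, show ((2 : ℕ) : ℤ) = 2 from rfl, show ((3 : ℕ) : ℤ) = 3 from rfl, h23, Finset.sum_filter, Finset.sum_singleton,
      if_pos hl23, t23, (wD_irr y).2.2.1, Nat.cast_one, one_mul]
  · rw [if_neg h]
    refine Finset.sum_eq_zero fun l hl => ?_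
    rw [LMset, Finset.mem_filter] at hl
    rcases mem_HBk_two_one hl.1 with h' | h' | h' | h' | h' | h'
    · rw [h'.1, t01, Nat.cast_zero, zero_mul]
    · rw [h'.1, t02, Nat.cast_zero, zero_mul]
    · rw [h'.1, t10, Nat.cast_zero, zero_mul]
    · -- `l = irr23`, `(a,b) = (2,3)`: then the slice condition forces `k = 1`, excluded
      exfalso
      obtain ⟨hl', ha, hb⟩ := h'
      have ha' : (a : ℕ) = 2 := by exact_mod_cast ha
      have hb' : (b : ℕ) = 3 := by exact_mod_cast hb
      have hk : k ≠ 1 := fun hk => h ⟨ha', hb', hk⟩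
      have hsz := hl.2
      rw [hl', hl23] at hsz
      unfold hatLen lchi at hsz
      rw [ha', hb'] at hsz
      norm_num at hsz
      omega
    · rw [h'.1, t32, Nat.cast_zero, zero_mul]
    · rw [h'.1, t31, Nat.cast_zero, zero_mul]

/-- ★ **The contact hat kernel of `S₂`**: `Ĉ_M(k) = cOneTwo y` for `k = 1` and `0` otherwise. [cite: DuminilCopinHammond2013, §2.2; lane «pcv-sawmu» a-p2 g26 — own] -/
theorem hatCM_two_eq (y : ℝ) (k : ℕ) : hatCM y k = if k = 1 then cOneTwo y else 0 := by
  ext a b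
  rw [hatCM_two_apply]
  by_cases hk : k = 1
  · subst hk
    rw [if_pos rfl]
    fin_cases a <;> fin_cases b <;> simp [cOneTwo]
  · rw [if_neg (fun h => hk h.2.2), if_neg hk, Matrix.zero_apply]

/-- `Ĉ_M(j) = 0` for `j ≠ 1`. [cite: DuminilCopinHammond2013, §2.2; lane plumbing] -/
theorem hatCM_two_eq_zero (y : ℝ) {j : ℕ} (hj : j ≠ 1) : hatCM y j = 0 := by
  rw [hatCM_two_eq, if_neg hj]

/-- `Ĉ_M(1) = cOneTwo y`. [cite: DuminilCopinHammond2013, §2.2; lane plumbing] -/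
theorem hatCM_two_one (y : ℝ) : hatCM y 1 = cOneTwo y := by
  rw [hatCM_two_eq, if_pos rfl]

/-- The inversion step shared by all collapses: `(1 + M̂(0))·(X − M̂(0)·X) = X` (since `M̂(0)² = 0`). [cite: Feller1968, XIII.3; lane plumbing] -/
theorem one_add_hatMZeroTwo_mul_sub (X : Matrix (Fin (2 * 2)) (Fin (2 * 2)) ℝ) :
    (1 + hatMZeroTwo) * (X - hatMZeroTwo * X) = X := by
  rw [Matrix.mul_sub, Matrix.add_mul, Matrix.one_mul, Matrix.add_mul, Matrix.one_mul, ← Matrix.mul_assoc, hatMZeroTwo_mul_self, Matrix.zero_mul]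
  abel

/-- `Ĉ_D(0) = 0` (`0 < y`): the renewal equation at `k = 0` reads `Ĉ_D(0) = M̂(0)·Ĉ_D(0)`, and `M̂(0)` is nilpotent.
[cite: Feller1968, XIII.3; DuminilCopinHammond2013, §2.2; lane «pcv-sawmu» a-p2 g26] -/
theorem hatCD_two_zero {y : ℝ} (hy : 0 < y) : hatCD y 0 = 0 := by
  have hren := hatCD_ren hy 0
  rw [Finset.Nat.antidiagonal_zero, Finset.sum_singleton] at hren
  simp only at hren
  rw [hatCM_two_eq_zero y Nat.zero_ne_one, Matrix.zero_mul, zero_add, zero_add, hatM_two_zero] at hren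
  -- hren : Ĉ0 = M̂0 · Ĉ0
  have h : hatMZeroTwo * hatCD y 0 = hatMZeroTwo * (hatMZeroTwo * hatCD y 0) := congrArg (hatMZeroTwo * ·) hren
  rw [← Matrix.mul_assoc, hatMZeroTwo_mul_self, Matrix.zero_mul] at h
  rw [h] at hren
  exact hren

/-- ★ `Ĉ_D(1) = K₁·(1 + M̂(0))` (`0 < y`). [cite: Feller1968, XIII.3; DuminilCopinHammond2013, §2.2; lane «pcv-sawmu» a-p2 g26] -/
theorem hatCD_two_one {y : ℝ} (hy : 0 < y) : hatCD y 1 = kOneTwo y * (1 + hatMZeroTwo) := by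
  have hren := hatCD_ren hy 1
  rw [Finset.Nat.sum_antidiagonal_succ, Finset.Nat.antidiagonal_zero, Finset.sum_singleton] at hren
  simp only at hren
  rw [hatCM_two_one, hatCM_two_eq_zero y Nat.zero_ne_one, Matrix.zero_mul, zero_add, hatM_two_zero, hatM_two_one, hatCD_two_zero hy,
    Matrix.mul_zero, add_zero, hatD_two_zero hy.le] at hren
  -- hren : Ĉ1 = cOne + (M̂0 Ĉ1 + cOne M̂0)
  have hsub : hatCD y 1 - hatMZeroTwo * hatCD y 1 = cOneTwo y * (1 + hatMZeroTwo) := by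
    rw [Matrix.mul_add, Matrix.mul_one, sub_eq_iff_eq_add]
    nth_rw 1 [hren]
    abel
  rw [kOneTwo_eq, Matrix.mul_assoc, ← hsub, one_add_hatMZeroTwo_mul_sub]

/-- ★★★ **The contact recursion of `S₂`**: `Ĉ_D(k+1) = G·Ĉ_D(k) + K₁·D̂(k)` for `k ≥ 1` (`0 < y`).  From #687's renewal equation: `Ĉ_M` is supported on
`{1}` and `M̂` on `{0,1}`, so `Ĉ_D(k+1) = M̂(0)Ĉ_D(k+1) + M̂(1)Ĉ_D(k) + Ĉ_M(1)D̂(k)`, and `(1 − M̂(0))⁻¹ = 1 + M̂(0)`.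
[cite: Feller1968, XIII.3, XIII.6; DuminilCopinHammond2013, §2.2; lane «pcv-sawmu» a-p2 g26 — own result] -/
theorem hatCD_two_succ {y : ℝ} (hy : 0 < y) {k : ℕ} (hk : 1 ≤ k) : hatCD y (k + 1) = gTwo y * hatCD y k + kOneTwo y * hatD 2 y k := by
  have hren := hatCD_ren hy (k + 1)
  rw [Finset.Nat.sum_antidiagonal_succ] at hren
  obtain ⟨m, rfl⟩ : ∃ m, k = m + 1 := ⟨k - 1, by omega⟩
  rw [Finset.Nat.sum_antidiagonal_succ] at hren
  have hrest : ∑ p ∈ antidiagonal m, (hatCM y (p.1 + 1 + 1) * hatD 2 y p.2 + hatM 2 y (p.1 + 1 + 1) * hatCD y p.2) = 0 :=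
    Finset.sum_eq_zero fun p _ => by
      rw [hatCM_two_eq_zero y (by omega), hatM_two_eq_zero y (by omega), Matrix.zero_mul, Matrix.zero_mul, add_zero]
  rw [hrest, add_zero, hatCM_two_eq_zero y (show m + 1 + 1 ≠ 1 by omega), zero_add, hatCM_two_eq_zero y (show 0 ≠ 1 by omega),
    Matrix.zero_mul, zero_add, hatM_two_zero] at hren
  simp only at hren
  rw [hatCM_two_one, hatM_two_one] at hren
  -- hren : Ĉ(m+2) = M̂0 · Ĉ(m+2) + (cOne · D̂(m+1) + M̂1 · Ĉ(m+1))
  have hsub : hatCD y (m + 1 + 1) - hatMZeroTwo * hatCD y (m + 1 + 1) = hatMOneTwo y * hatCD y (m + 1) + cOneTwo y * hatD 2 y (m + 1) := by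
    rw [sub_eq_iff_eq_add']
    nth_rw 1 [hren]
    abel
  rw [gTwo_eq, kOneTwo_eq, Matrix.mul_assoc, Matrix.mul_assoc, ← Matrix.mul_add, ← hsub, one_add_hatMZeroTwo_mul_sub]

/-- ★★ **The unrolled contact sums**: `Ĉ_D(k+1) = Σ_{j ≤ k} G^{k−j}·K₁·G^j·(1 + M̂(0))` for every `k` (`0 < y`) — the finite convolution of the geometric
sequences `G^i·K₁` and `D̂(j) = G^j·(1 + M̂(0))`. [cite: Feller1968, XIII.6 (renewal argument for moments); lane «pcv-sawmu» a-p2 g26 — own result] -/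
theorem hatCD_two_eq_sum {y : ℝ} (hy : 0 < y) (k : ℕ) :
    hatCD y (k + 1) = ∑ j ∈ Finset.range (k + 1), gTwo y ^ (k - j) * kOneTwo y * gTwo y ^ j * (1 + hatMZeroTwo) := by
  induction k with
  | zero => rw [Finset.sum_range_one, Nat.sub_self, pow_zero, Matrix.one_mul, Matrix.mul_one, hatCD_two_one hy]
  | succ k ih =>
    rw [hatCD_two_succ hy (by omega), ih, hatD_two_eq_pow_mul hy.le (by omega),
      Finset.sum_range_succ (fun j => gTwo y ^ (k + 1 - j) * kOneTwo y * gTwo y ^ j * (1 + hatMZeroTwo)) (k + 1), Nat.sub_self, pow_zero,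
      Matrix.one_mul, Finset.mul_sum, Matrix.mul_assoc (kOneTwo y)]
    congr 1
    refine Finset.sum_congr rfl fun j hj => ?_
    rw [Finset.mem_range] at hj
    rw [show k + 1 - j = k - j + 1 by omega, pow_succ']
    simp only [Matrix.mul_assoc]

/-! ## The squared-contact sums -/

/-- The squared-contact hat bridge sum of `S₂`: `Ĉ²_D(k)_{ab} = Σ_{bridges a→b with 2k+χ_a−χ_b steps} #top² · wD` (the matrix of #750's `hat_contactSq_ren`).
[cite: Feller1968, XIII.6; DuminilCopinHammond2013, §2.2; lane «pcv-sawmu» a-p2 g26] -/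
def hatC2D (y : ℝ) (k : ℕ) : Matrix (Fin (2 * 2)) (Fin (2 * 2)) ℝ :=
  Matrix.of fun a b : Fin (2 * 2) => ∑ l ∈ LUset 2 (2 * k + 1) (hatLen k a b) (a : ℕ) (b : ℕ), (topCnt 2 l.tail : ℝ) ^ 2 * wD 2 y l

/-- The squared-contact hat irreducible sum of `S₂`: `Ĉ²_M(k)_{ab} = Σ_{irreducible bridges a→b with 2k+χ_a−χ_b steps} #top² · wD`.
[cite: Feller1968, XIII.6; DuminilCopinHammond2013, §2.2; lane «pcv-sawmu» a-p2 g26] -/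
def hatC2M (y : ℝ) (k : ℕ) : Matrix (Fin (2 * 2)) (Fin (2 * 2)) ℝ :=
  Matrix.of fun a b : Fin (2 * 2) => ∑ l ∈ LMset 2 (2 * k + 1) (hatLen k a b) (a : ℕ) (b : ℕ), (topCnt 2 l.tail : ℝ) ^ 2 * wD 2 y l

/-- `Ĉ²_M(k) = Ĉ_M(k)` at width two: each irreducible bridge of `S₂` has `0` or `1` surface contact in its tail (#715), and `c² = c` on `{0,1}`.
[cite: DuminilCopinHammond2013, §2.2; lane «pcv-sawmu» a-p2 g26] -/
theorem hatC2M_two_eq (y : ℝ) (k : ℕ) : hatC2M y k = hatCM y k := by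
  obtain ⟨t01, t10, t23, t32, t02, t31⟩ := topCnt_tail_irr
  ext a b
  rw [hatC2M, hatCM, Matrix.of_apply, Matrix.of_apply]
  refine Finset.sum_congr rfl fun l hl => ?_
  rw [LMset, Finset.mem_filter] at hl
  rcases mem_HBk_two_one hl.1 with h' | h' | h' | h' | h' | h' <;> rw [h'.1] <;> simp [t01, t10, t23, t32, t02, t31]

/-- #750's squared-contact renewal equation at `T = 2`, in the names of this file:
`Ĉ²_D(k) = Ĉ²_M(k) + Σ_{i+j=k} (Ĉ²_M(i)·D̂(j) + 2·(Ĉ_M(i)·Ĉ_D(j)) + M̂(i)·Ĉ²_D(j))` (`0 < y`). [cite: Feller1968, XIII.6; DuminilCopinHammond2013, §2.2; lane plumbing] -/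
theorem hatC2D_ren {y : ℝ} (hy : 0 < y) (k : ℕ) :
    hatC2D y k = hatC2M y k +
      ∑ p ∈ antidiagonal k, (hatC2M y p.1 * hatD 2 y p.2 + (2 : ℝ) • (hatCM y p.1 * hatCD y p.2) + hatM 2 y p.1 * hatC2D y p.2) :=
  hat_contactSq_ren (T := 2) hy k

/-- `Ĉ²_D(0) = 0` (`0 < y`). [cite: Feller1968, XIII.6; DuminilCopinHammond2013, §2.2; lane «pcv-sawmu» a-p2 g26] -/
theorem hatC2D_two_zero {y : ℝ} (hy : 0 < y) : hatC2D y 0 = 0 := by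
  have hren := hatC2D_ren hy 0
  rw [Finset.Nat.antidiagonal_zero, Finset.sum_singleton] at hren
  simp only [hatC2M_two_eq, hatCM_two_eq_zero y Nat.zero_ne_one, Matrix.zero_mul, smul_zero, zero_add, add_zero, hatM_two_zero] at hren
  -- hren : Ĉ²0 = M̂0 · Ĉ²0
  have h : hatMZeroTwo * hatC2D y 0 = hatMZeroTwo * (hatMZeroTwo * hatC2D y 0) := congrArg (hatMZeroTwo * ·) hren
  rw [← Matrix.mul_assoc, hatMZeroTwo_mul_self, Matrix.zero_mul] at h
  rw [h] at hren
  exact hren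

/-- `Ĉ²_D(1) = K₁·(1 + M̂(0))` (`= Ĉ_D(1)`: a bridge of `S₂` with hat index `1` has at most one contact) (`0 < y`).
[cite: Feller1968, XIII.6; DuminilCopinHammond2013, §2.2; lane «pcv-sawmu» a-p2 g26] -/
theorem hatC2D_two_one {y : ℝ} (hy : 0 < y) : hatC2D y 1 = kOneTwo y * (1 + hatMZeroTwo) := by
  have hren := hatC2D_ren hy 1
  rw [Finset.Nat.sum_antidiagonal_succ, Finset.Nat.antidiagonal_zero, Finset.sum_singleton] at hren
  simp only [hatC2M_two_eq, hatCM_two_one, hatCM_two_eq_zero y Nat.zero_ne_one, Matrix.zero_mul, Matrix.mul_zero, smul_zero, zero_add,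
    add_zero, hatM_two_zero, hatM_two_one, hatCD_two_zero hy, hatC2D_two_zero hy, hatD_two_zero hy.le] at hren
  -- hren : Ĉ²1 = cOne + (M̂0 Ĉ²1 + cOne M̂0)
  have hsub : hatC2D y 1 - hatMZeroTwo * hatC2D y 1 = cOneTwo y * (1 + hatMZeroTwo) := by
    rw [Matrix.mul_add, Matrix.mul_one, sub_eq_iff_eq_add]
    nth_rw 1 [hren]
    abel
  rw [kOneTwo_eq, Matrix.mul_assoc, ← hsub, one_add_hatMZeroTwo_mul_sub]

/-- ★★★ **The squared-contact recursion of `S₂`**: `Ĉ²_D(k+1) = G·Ĉ²_D(k) + K₁·D̂(k) + 2·(K₁·Ĉ_D(k))` for `k ≥ 1` (`0 < y`): #750's renewal equation with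
`Ĉ²_M = Ĉ_M` supported on `{1}` and `M̂` on `{0,1}`, inverted by `1 + M̂(0)`.  Together with `hatCD_two_succ` / `hatD_two_succ` this is a closed
first-order linear system for `(D̂, Ĉ_D, Ĉ²_D)` driven by the single matrix `G`.
[cite: Feller1968, XIII.6 (second moments by the renewal argument); DuminilCopinHammond2013, §2.2; lane «pcv-sawmu» a-p2 g26 — own result] -/
theorem hatC2D_two_succ {y : ℝ} (hy : 0 < y) {k : ℕ} (hk : 1 ≤ k) :
    hatC2D y (k + 1) = gTwo y * hatC2D y k + kOneTwo y * hatD 2 y k + (2 : ℝ) • (kOneTwo y * hatCD y k) := by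
  have hren := hatC2D_ren hy (k + 1)
  rw [Finset.Nat.sum_antidiagonal_succ] at hren
  obtain ⟨m, rfl⟩ : ∃ m, k = m + 1 := ⟨k - 1, by omega⟩
  rw [Finset.Nat.sum_antidiagonal_succ] at hren
  have hrest : ∑ p ∈ antidiagonal m, (hatC2M y (p.1 + 1 + 1) * hatD 2 y p.2 + (2 : ℝ) • (hatCM y (p.1 + 1 + 1) * hatCD y p.2) +
      hatM 2 y (p.1 + 1 + 1) * hatC2D y p.2) = 0 :=
    Finset.sum_eq_zero fun p _ => by
      rw [hatC2M_two_eq, hatCM_two_eq_zero y (by omega), hatM_two_eq_zero y (by omega), Matrix.zero_mul, Matrix.zero_mul, Matrix.zero_mul,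
        smul_zero, add_zero, add_zero]
  rw [hrest, add_zero] at hren
  simp only [hatC2M_two_eq, hatCM_two_eq_zero y (show m + 1 + 1 ≠ 1 by omega), hatCM_two_eq_zero y (show 0 ≠ 1 by omega), Matrix.zero_mul,
    smul_zero, zero_add, hatM_two_zero, zero_add, hatCM_two_one, hatM_two_one] at hren
  -- hren : Ĉ²(m+2) = M̂0 · Ĉ²(m+2) + (cOne · D̂(m+1) + 2 • (cOne · Ĉ(m+1)) + M̂1 · Ĉ²(m+1))
  have hsub : hatC2D y (m + 1 + 1) - hatMZeroTwo * hatC2D y (m + 1 + 1) =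
      hatMOneTwo y * hatC2D y (m + 1) + cOneTwo y * hatD 2 y (m + 1) + (2 : ℝ) • (cOneTwo y * hatCD y (m + 1)) := by
    rw [sub_eq_iff_eq_add']
    nth_rw 1 [hren]
    abel
  rw [gTwo_eq, kOneTwo_eq, Matrix.mul_assoc, Matrix.mul_assoc, Matrix.mul_assoc, ← Matrix.mul_smul, ← Matrix.mul_add, ← Matrix.mul_add, ← hsub,
    one_add_hatMZeroTwo_mul_sub]

end W2

end HV

end Literature.Probability.RandomPlanarGeometry.SAW
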